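import Summits.BirchSwinnertonDyer.BirchSwinnertonDyer.Theorems.KolyvaginRoadThreeMethod2Cheb
import Summits.BirchSwinnertonDyer.BirchSwinnertonDyer.Theorems.KolyvaginRoadThreeMethod2StubAOfChebIsoTame
import Summits.BirchSwinnertonDyer.BirchSwinnertonDyer.Theorems.KolyvaginRoadThreeMethod2Iso
import HarnessLib

/-!
# Method 2 at `p = 3` — stub A of crux 19574 from the tame sign law (TS) alone

Sub-problem `BirchSwinnertonDyer`, route `KolyvaginRoadThree`, METHOD line on the crux `ZhangSharpFrameAtThreeHL`
(`stmt-BirchSwinnertonDyer-19574`).  koly3a reduced the REGISTERED stub A `stub_levelRaisingAtThree` (rank lowering at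
one new good unipotent-admissible prime, skeleton v2x/v2y text) to five local–global inputs
(`selQ_rankLowering_on_of_localGlobal`): (Cheb), (Equiv), (Line), (Trans), (Iso).  State of the tree:
(Line), (Trans) — `localLine_of_uAdmissible`, `localTrans_of_uAdmissible` (zhang3-p1) and `hline`, `htrans` (koly);
(Iso) — `Iso.hiso` (koly, Poitou–Tate see-saw); (Equiv) ⟸ (TS) — `localEquiv_of_tameSign` (zhang3-p1); and now
(Cheb) — `Cheb.hcheb` (this seat, file `KolyvaginRoadThreeMethod2Cheb`).  Hence:

* `hcheb` — (Cheb) in koly3a's binder shape, from `Cheb.exists_uAdmissible_loc_ne_zero`.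
* `stub_levelRaisingAtThree_of_tameSign` — the REGISTERED text of stub A from the frame-wise TAME SIGN LAW (TS) ALONE:
  at every place `v ∋ q` of a unipotent-admissible `q`, for every arithmetic Frobenius `h ∈ Γ_ℚ` below the prime cut out
  by the chosen embedding whose transport lifts `c` and every `F ∈ Γ_K` with `res F = h²`, every continuous cocycle
  `φ : Γ_K → E(K̄)[3]` has `φ(t⁻¹ i t) = φ(i) = φ(F i F⁻¹)` on the inertia group `I_𝔓` (Serre 1972 §1.8 Prop. 6:
  Frobenius conjugation raises tame inertia to the `q`-th power, `q ≡ q² ≡ 1 (mod 3)`; tree supplier in local-field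
  form `InertiaHomFrobeniusTwist`, number-field bridge in progress by zhang3-p1).

CONDITIONAL on (TS); the stub is not proved outright and nothing is booked.
References: [cite: WZhang2014, Prop. 5.4, Lemma 7.3, §9 (9.1)–(9.3)] [cite: SerreInventiones1972, §1.8 Prop. 6].
-/

noncomputable section

open scoped Classical Pointwise
open Polynomial

namespace Summit.BirchSwinnertonDyer.Rank1Residual.X11b.Three.Koly.Method2.Cheb

open WeierstrassCurve Field Function NumberField IsDedekindDomain Rat.HeightOneSpectrum
open Literature.NumberTheory.EllipticCurves Literature.NumberTheory.GaloisRepresentations Module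
open Summit.BirchSwinnertonDyer.BirchSwinnertonDyer.Theorems

section Binder

open Summit.BirchSwinnertonDyer.Rank1Residual.X11b.Three.Koly.Method2
open Literature.NumberTheory.EllipticCurves.ModularForms

variable (W : WeierstrassCurve ℚ) (K : Type) [Field K] [NumberField K] [W.IsElliptic] [W.IsGloballyMinimal]

/-- **(Cheb) — the Čebotarev input of koly3a's `selQ_rankLowering_on_of_localGlobal`, discharged** on the frame:
for every non-zero `x` of a good-level eigen-Selmer space `Sel_n^μ` there is a NEW unipotent-admissible prime `q ∉ n`
with `Frob_q² ≠ 1` on `E[3]` and non-zero localisation of `x` at a place `v ∣ q` (from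
`exists_uAdmissible_loc_ne_zero`, the sign being `sgn μ`: `c_* x = sgn μ · x` for `x ∈ Sel_n^μ`).
[cite: WZhang2014, Lemma 7.3] [cite: BertoliniDarmon2005, Thm. 3.2] -/
theorem hcheb (hK : IsImaginaryQuadratic K) (hsurj : Literature.NumberTheory.EllipticCurves.Rank1Residual.Surj W 3)
    (hmult : W.HasMultiplicativeReductionAtPrime 3) (hH : SatisfiesHeegnerHypothesis (W.conductorNorm ℤ) K)
    {c : K ≃ₐ[ℚ] K} (hc1 : c ≠ 1) [Module (ZMod 3) (V3 W K)] :
    ∀ (n : Finset {q // IsUAdmissiblePrime W K q}) (μ : Bool) (x : V3 W K), GoodLevel W K n →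
      x ∈ SelQ W K c n μ → x ≠ 0 →
      ∃ q : {q // IsUAdmissiblePrime W K q}, q ∉ n ∧ FrobSqNeOneAt W 3 q.1 ∧ ∃ v : HeightOneSpectrum (𝓞 K),
        ((q : ℕ) : 𝓞 K) ∈ v.asIdeal ∧
          (W.baseChange K).torsionLocMap (v.adicCompletion K) ((3 ^ 1 : ℕ) : ℤ) x ≠ 0 := by
  intro n μ x _ hx hx0
  have hν : sgn μ = 1 ∨ sgn μ = -1 := by cases μ <;> simp [sgn]
  have hxν : conjAct W c ((3 : ℕ) : ℤ) x = sgn μ • x := conjAct_eq_of_mem_selQ W K c n μ hx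
  obtain ⟨q, hqB, hqU, hFr, v, hqv, hnk⟩ :=
    exists_uAdmissible_loc_ne_zero W K hK hsurj hmult hH hc1 hν (x := x) hx0 hxν (n.image Subtype.val)
  refine ⟨⟨q, hqU⟩, fun hqn ↦ hqB (Finset.mem_image.mpr ⟨⟨q, hqU⟩, hqn, rfl⟩), hFr, v, hqv, ?_⟩
  exact hnk

/-- **`stub_levelRaisingAtThree` — the REGISTERED text of stub A of crux 19574 — FROM THE TAME SIGN LAW (TS) ALONE,
frame-wise.**  zhang3-p1's `stub_levelRaisingAtThree_of_cheb_iso_tameSign` fed with `hcheb` (this file's parent) and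
`Iso.hiso`; the conclusion is the registered stub signature VERBATIM.  CONDITIONAL on (TS); nothing is booked.
[cite: WZhang2014, Prop. 5.4, Lemma 7.3, §9 (9.1)–(9.3)] [cite: SerreInventiones1972, §1.8 Prop. 6] -/
theorem stub_levelRaisingAtThree_of_tameSign
    (hTS : ∀ (W : WeierstrassCurve ℚ) [W.IsElliptic] [W.IsGloballyMinimal] [NeZero (W.conductorNorm ℤ)] (K : Type)
      [Field K] [NumberField K] (Dt : ModularParametrizationData W (W.conductorNorm ℤ)) (β : ℤ) (ι : K →+* ℂ),
      Summit.BirchSwinnertonDyer.Rank1Residual.ClassX11b W 3 → W.HasMultiplicativeReductionAtPrime 3 →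
      Literature.NumberTheory.EllipticCurves.Rank1Residual.Surj W 3 →
      Literature.NumberTheory.EllipticCurves.Rank1Residual.Ram W 3 → ¬ 3 ∣ W.tamagawaProduct →
      IsImaginaryQuadratic K → Odd (NumberField.discr K) → SatisfiesHeegnerHypothesis (W.conductorNorm ℤ) K →
      (W.quadraticTwist (NumberField.discr K : ℚ)).entireLFunction 1 ≠ 0 → NumberField.discr K ≠ -3 →
      (4 * (W.conductorNorm ℤ : ℤ)) ∣ β ^ 2 - NumberField.discr K → ¬ (3 : ℤ) ∣ Dt.c →
      ∀ (c : K ≃ₐ[ℚ] K), c ≠ 1 →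
      -- (TS) the tame sign law at the places above unipotent-admissible primes
      (∀ (v : HeightOneSpectrum (𝓞 K)) (𝔐 : Ideal (HeightOneSpectrum.localAbsIntegers v)),
        𝔐 ∈ v.localPrimesAbove → ∀ q : ℕ, IsUAdmissiblePrime W K q → (q : 𝓞 K) ∈ v.asIdeal →
        ∀ (h : absoluteGaloisGroup ℚ) (F : absoluteGaloisGroup K),
          IsArithFrobAt (𝓞 ℚ) h ((v.primeBelow (closureEmb (K := K) (v.adicCompletion K)) 𝔐).comap
            (absIntegersMap ℚ K)) → absGaloisRestrict ℚ K F = h ^ 2 →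
        ∀ (ht : IsLiftOfAut c (absGaloisTransport (K := ℚ) (L := K) h).toRingEquiv)
          (φ : contOneCocycles (discreteTopRep (absoluteGaloisGroup K)
            (geomTorsion (W.baseChange K) ((3 ^ 1 : ℕ) : ℤ)))),
        ∀ i ∈ (v.primeBelow (closureEmb (K := K) (v.adicCompletion K)) 𝔐).inertia (absoluteGaloisGroup K),
          φ.1 (ht.conjGalCMH i) = φ.1 i ∧ φ.1 (F * i * F⁻¹) = φ.1 i)) :
    ∀ (W : WeierstrassCurve ℚ) [W.IsElliptic] [W.IsGloballyMinimal] [NeZero (W.conductorNorm ℤ)] (K : Type)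
      [Field K] [NumberField K] (Dt : ModularParametrizationData W (W.conductorNorm ℤ)) (β : ℤ) (ι : K →+* ℂ),
      Summit.BirchSwinnertonDyer.Rank1Residual.ClassX11b W 3 → W.HasMultiplicativeReductionAtPrime 3 →
      Literature.NumberTheory.EllipticCurves.Rank1Residual.Surj W 3 →
      Literature.NumberTheory.EllipticCurves.Rank1Residual.Ram W 3 → ¬ 3 ∣ W.tamagawaProduct →
      IsImaginaryQuadratic K → Odd (NumberField.discr K) → SatisfiesHeegnerHypothesis (W.conductorNorm ℤ) K →
      (W.quadraticTwist (NumberField.discr K : ℚ)).entireLFunction 1 ≠ 0 → NumberField.discr K ≠ -3 →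
      (4 * (W.conductorNorm ℤ : ℤ)) ∣ β ^ 2 - NumberField.discr K → ¬ (3 : ℤ) ∣ Dt.c →
      ∀ (c : K ≃ₐ[ℚ] K), c ≠ 1 → ∀ [Module (ZMod 3) (V3 W K)],
      -- (A1) rank lowering at one new GOOD (non-scalar) unipotent-admissible prime, on good levels, (9.1)–(9.2)
      (∀ (n : Finset {q // IsUAdmissiblePrime W K q}) (μ : Bool) (x : V3 W K),
        GoodLevel W K n → x ∈ SelQ W K c n μ → x ≠ 0 →
        ∃ q : {q // IsUAdmissiblePrime W K q}, q ∉ n ∧ GoodLevel W K (insert q n) ∧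
          x ∉ SelQ W K c (insert q n) μ ∧
          SelQ W K c (insert q n) μ ≤ SelQ W K c n μ ∧
          finrank (ZMod 3) (SelQ W K c (insert q n) μ) + 1 = finrank (ZMod 3) (SelQ W K c n μ) ∧
          SelQ W K c (insert q n) (!μ) = SelQ W K c n (!μ)) := by
  refine stub_levelRaisingAtThree_of_cheb_iso_tameSign fun W _ _ _ K _ _ Dt β ι hX hmult hsurj hram htam hK hodd hH
    hLt h3 hβ hc c hc1 _ ↦ ⟨?_, ?_, ?_⟩
  · exact hcheb W K hK hsurj hmult hH hc1
  · exact Iso.hiso W K c hK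
  · exact hTS W K Dt β ι hX hmult hsurj hram htam hK hodd hH hLt h3 hβ hc c hc1

end Binder

end Summit.BirchSwinnertonDyer.Rank1Residual.X11b.Three.Koly.Method2.Cheb

end
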